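import Summits.QuantumAdvantage.QuantumAdvantage.Theorems.LightDialB
import Summits.QuantumAdvantage.QuantumAdvantage.Theorems.LightDialC5
import HarnessLib

/-!
# ParityDial (A) — decomp-qadv lens-2 (structural dichotomy: special vs generic), generation 27, part 1/2

TARGET (by name): the law-bet of NODE «LightDial» (g26, tree `Theorems.LightDial`), `LightFail 2 7` — «eventually in `n`, every
`𝔽₃`-degree-`≤ 2` strategy of the cyclic ring game loses on an odd-class input of Hamming weight `≤ 7`» — which gives
`Theses.ExactnessDial.NoPerfectTwo3` (stmt-QuantumAdvantage-27432) by `LightDial.closes 7`.  Status of the bet after g26: `¬ LightFail 2 5`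
(tree `not_lightFail_two_five`: the predecessor rule `predW = E + 2·E·O + 2·x_{b+1}` is perfect on weight `≤ 5` for every even `n ≥ 10`),
`predW` itself dies at weight `7` (`predW_not_perfect_seven`), `LightFail 2 7` UNDECIDED.

THE DIAL OF THIS GENERATION (special vs generic RULES, inside the light dial).  Every structured survivor the cell has met at weight 5 —
`predW`, its mirror, the affine/quadratic COMB rules `c₀ + αE_b + βO_b + …` (E_b, O_b = number of ones at even / odd offset from `b`), the
`W_odd`-type rules — reads the input only through (i) the PARITY CLASS of the position, (ii) a bounded WINDOW around it, (iii) GLOBAL data of the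
input (the comb counts).  SPECIAL := the PARITY-LOCAL rules of radius `r`: `z_b = F(b mod 2, x|[b−r, b+r], a(x))`, `F` and the advice `a`
arbitrary (no degree bound at all); intrinsically (`IsParityLocal`): on every input, two positions of equal parity and equal radius-`r` window
get equal answers.  GENERIC := the degree-`≤ 2` strategies that are NOT parity-local.

★ THEOREM (`pLocalFail_one_seven`, part B; degree-free): for every EVEN `n ≥ 22` there is ONE odd-class input of weight `7` — ones at
`{1,3,6,10,13,16,19}` (`n ≡ 0 mod 4`, family A here) resp. `{1,3,6,8,11,14,19}` (`n ≡ 2 mod 4`, family B) — on which EVERY parity-local rule of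
radius `1` with EVERY global advice violates the relation (`ParityUniversalHard 1 x`).  So the special side of `LightFail 2 7` is CLOSED at
exactly the weight where the g26 data put the threshold (`7 = 2·2 + 3`), by a certificate that ignores the degree.
ENGINE (`parityUniversalHard_of_pairing`, from lens-1's tree lemma `LightConeWindowHard.dot2_eq_zero_of_pairing`): a kernel vector `v` of `x`
with sign bit `1` and a fixed-point-free involution `σ` of `supp v` preserving BOTH the radius-`r` window AND the position parity makes
`Σ_{b ∈ supp v} z_b` even for every parity-local `z`, contradicting `Rel`.  WHY WEIGHT 7 AND NOT 5 (memo NODE-g27.md §2): write the kernel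
vector by the two-state automaton (value on the even / odd sublattice; a one at `a` with `v_a = 1` flips the OTHER sublattice); the type
multiset of a one is one of three local patterns A = (in-state (1,1)), B = (1,0), C = (0,1), and the parity-labelled offset types have even
multiplicities iff each parity class of ones is a union of equal pairs and A+B+C triples — an odd weight forces one triple plus pairs, i.e.
weight `≥ 7`; the brute-force search confirms: no parity-universal-hard input of weight `≤ 7` exists for `n ≤ 20`, and none of weight `≤ 5` can
exist at all since `predW` (parity-local, radius 1) is perfect there.
MULTI-INPUT COMPLEMENT (numerics, `g27/num/plocal_lin.py`, table `num/plocal_sweep.out`; the constraints are 𝔽₂-LINEAR in the truth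
table of `F`): with the comb advice `(N_E, N_O) mod 3` the parity-local class of radius `r` is DEAD at weight 7 exactly when `n ≥ 2r + 10`
in the range computed (`r = 1`: every even `12 ≤ n ≤ 22`; `r = 2`: `14 ≤ n ≤ 22`; `r = 3`: `16 ≤ n ≤ 22`; inconsistent advice classes
`(0,1), (1,0), (2,2)`), ALIVE at weight 5 everywhere, and for `n ≤ 2r + 8` a parity-local rule perfect on the WHOLE odd class exists
(`n = 12, r = 2`; `n = 14, r = 3`; `n = 16, r = 4`) — the degree-free shadow of the census cell K-LD1(16,7).  DILATION LAW (numerics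
`num/dilation.out`, paper proof memo §4): the `f`-fold dilation (`f` odd) of families A/B, far-pumped, is parity-universal-hard at every radius
`r < f` — the typed next rung `∀ r, PLocalFail r 7`.

Main declarations (this part): `par`, `plocStrat`, `ParityUniversalHard`, `not_rel_ploc_of_pairing`, `parityUniversalHard_of_pairing`,
`parityUniversalHard_any_advice`, `universalHard_of_parity`, family A `xA`/`vA`/`σA` with `xA_parityUniversalHard` (`n ≡ 0 mod 4`, `n ≥ 24`).
Part B: family B, `parityUniversalHard_one_all`, the class `IsParityLocal`, the pieces `PLocalFail` (PROVED at `(1,7)`) / `PGlobalFail` /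
`LightFailOdd`, the node `lightFail_iff_pieces`, `closes`.  `lean check` rc 0 · 0 sorry · no `native_decide`; axioms standard.
-/

set_option linter.dupNamespace false
set_option linter.style.longLine false

noncomputable section
open scoped Classical

namespace Summit.QuantumAdvantage.QuantumAdvantage.Theorems.ParityDial
open Finset
open Literature.Computability.QuantumComplexity Literature.Computability.QuantumComplexity.RingHLF
open Summit.QuantumAdvantage.AdviceFreeQNC0 (OddZeros)
open Summit.QuantumAdvantage.AdviceFreeQNC0.LightConeWindowHard
  (window window_apply dot2_eq_zero_of_pairing nxt_val prv_val xor3_eq_false_iff UniversalHard)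
open Summit.QuantumAdvantage.QuantumAdvantage.Theorems.LightDial (wt wt_le_of_val_mem)

variable {n : ℕ}

/-! ## §1 Parity-local rules and the pairing engine -/

/-- the parity class of a ring position (`true` = even). -/
def par (i : Fin n) : Bool := decide ((i : ℕ) % 2 = 0)

/-- the PARITY-LOCAL strategy of radius `r` with rule table `F`: `z_i = F (parity of i) (x|[i−r, i+r])`.  Any input-global advice is a
constant along one input and is absorbed into `F` (`parityUniversalHard_any_advice`). -/
def plocStrat (r : ℕ) (F : Bool → (Fin (2 * r + 1) → Bool) → Bool) (x : Fin n → Bool) : Fin n → Bool :=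
  fun i => F (par i) (window r x i)

/-- `x` is PARITY-UNIVERSAL-HARD at radius `r`: it lies in the odd class and EVERY parity-local rule of radius `r` violates the ring
relation on it. -/
def ParityUniversalHard (r : ℕ) (x : Fin n → Bool) : Prop :=
  OddZeros x ∧ ∀ F : Bool → (Fin (2 * r + 1) → Bool) → Bool, ¬ Rel x (plocStrat r F x)

/-- ENGINE: a kernel vector with sign bit `1` whose support carries a fixed-point-free involution preserving window AND parity defeats
every parity-local rule. -/
theorem not_rel_ploc_of_pairing (r : ℕ) (x v : Fin n → Bool) (σ : Fin n → Fin n)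
    (hK : InKernel x v) (hsign : signBit x v = 1)
    (hσv : ∀ b, v b = true → v (σ b) = true) (hσw : ∀ b, v b = true → window r x (σ b) = window r x b)
    (hσp : ∀ b, v b = true → par (σ b) = par b)
    (hfix : ∀ b, v b = true → σ b ≠ b) (hinv : ∀ b, v b = true → σ (σ b) = b)
    (F : Bool → (Fin (2 * r + 1) → Bool) → Bool) : ¬ Rel x (plocStrat r F x) := by
  intro h
  have h1 := h v hK
  rw [dot2_eq_zero_of_pairing v _ σ hσv (fun b hb => by simp only [plocStrat, hσw b hb, hσp b hb]) hfix hinv, hsign] at h1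
  exact absurd h1 (by decide)

/-- `ParityUniversalHard` from a certificate. -/
theorem parityUniversalHard_of_pairing (r : ℕ) (x v : Fin n → Bool) (σ : Fin n → Fin n)
    (hodd : OddZeros x) (hK : InKernel x v) (hsign : signBit x v = 1)
    (hσv : ∀ b, v b = true → v (σ b) = true) (hσw : ∀ b, v b = true → window r x (σ b) = window r x b)
    (hσp : ∀ b, v b = true → par (σ b) = par b)
    (hfix : ∀ b, v b = true → σ b ≠ b) (hinv : ∀ b, v b = true → σ (σ b) = b) : ParityUniversalHard r x :=
  ⟨hodd, fun F => not_rel_ploc_of_pairing r x v σ hK hsign hσv hσw hσp hfix hinv F⟩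

/-- ANY ADVICE: a parity-universal-hard input defeats every parity-local rule with every input-global advice of every type. -/
theorem parityUniversalHard_any_advice {r : ℕ} {x : Fin n → Bool} (h : ParityUniversalHard r x) {α : Type*}
    (adv : (Fin n → Bool) → α) (F : Bool → (Fin (2 * r + 1) → Bool) → α → Bool) :
    ¬ Rel x (fun i => F (par i) (window r x i) (adv x)) :=
  h.2 (fun p w => F p w (adv x))

/-- parity-universal hardness refines lens-1's `UniversalHard` (window rules that ignore the parity). -/
theorem universalHard_of_parity {r : ℕ} {x : Fin n → Bool} (h : ParityUniversalHard r x) : UniversalHard r x :=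
  ⟨h.1, fun F => h.2 (fun _ w => F w)⟩

/-! ## §2 Family A (`n ≡ 0 mod 4`, `n ≥ 24`): ones `{1,3,6,10,13,16,19}`; kernel support = all but `{2,7,9,14,16,18}`; sign bit 1;
pairing = 9 table pairs on `[0,24)` + blocks of four on `[24, n)`.  All facts are linear case lists closed by `omega`. -/

/-- family A: the input with ones at `{1, 3, 6, 10, 13, 16, 19}` (weight 7), any length `n`. -/
def xA (n : ℕ) : Fin n → Bool := fun j => decide ((j : ℕ) = 1 ∨ (j : ℕ) = 3 ∨ (j : ℕ) = 6 ∨ (j : ℕ) = 10 ∨ (j : ℕ) = 13 ∨ (j : ℕ) = 16 ∨ (j : ℕ) = 19)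
/-- its kernel support: every position except `{2, 7, 9, 14, 16, 18}` (for `n ≡ 0 (mod 4)`, `n ≥ 24`). -/
abbrev VA (t : ℕ) : Prop := t ≠ 2 ∧ t ≠ 7 ∧ t ≠ 9 ∧ t ≠ 14 ∧ t ≠ 16 ∧ t ≠ 18
/-- ParityDial helper `vA`: the kernel vector of `xA` as a Boolean function. -/
def vA (n : ℕ) : Fin n → Bool := fun b => decide (VA b)
/-- the pairing of `supp vA`: a table on `[0, 24)` (9 pairs of equal parity and equal radius-1 window) and the
blocks `t ↦ t ± 2` on the far stretch `[24, n)` (all windows zero there). -/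
def σAval (t : ℕ) : ℕ :=
  if 24 ≤ t then (if (t - 24) % 4 < 2 then t + 2 else t - 2)
  else if t = 0 then 12
  else if t = 1 then 3
  else if t = 3 then 1
  else if t = 4 then 20
  else if t = 5 then 15
  else if t = 6 then 10
  else if t = 8 then 22
  else if t = 10 then 6
  else if t = 11 then 17
  else if t = 12 then 0
  else if t = 13 then 19
  else if t = 15 then 5
  else if t = 17 then 11
  else if t = 19 then 13
  else if t = 20 then 4
  else if t = 21 then 23
  else if t = 22 then 8
  else if t = 23 then 21
  else t
/-- ParityDial helper `σA`: the pairing as a map `Fin n → Fin n`. -/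
def σA (n : ℕ) : Fin n → Fin n := fun b => ⟨min (σAval b) (n - 1), by have := b.isLt; omega⟩

/-- ParityDial helper `σA_val`: the value of the pairing on the support, as a case list. -/
theorem σA_val (hn : 24 ≤ n) (h4 : n % 4 = 0) (b : Fin n) (hb : vA n b = true) :
    ((b : ℕ) = 0 ∧ ((σA n b : Fin n) : ℕ) = 12) ∨
    ((b : ℕ) = 1 ∧ ((σA n b : Fin n) : ℕ) = 3) ∨
    ((b : ℕ) = 3 ∧ ((σA n b : Fin n) : ℕ) = 1) ∨
    ((b : ℕ) = 4 ∧ ((σA n b : Fin n) : ℕ) = 20) ∨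
    ((b : ℕ) = 5 ∧ ((σA n b : Fin n) : ℕ) = 15) ∨
    ((b : ℕ) = 6 ∧ ((σA n b : Fin n) : ℕ) = 10) ∨
    ((b : ℕ) = 8 ∧ ((σA n b : Fin n) : ℕ) = 22) ∨
    ((b : ℕ) = 10 ∧ ((σA n b : Fin n) : ℕ) = 6) ∨
    ((b : ℕ) = 11 ∧ ((σA n b : Fin n) : ℕ) = 17) ∨
    ((b : ℕ) = 12 ∧ ((σA n b : Fin n) : ℕ) = 0) ∨
    ((b : ℕ) = 13 ∧ ((σA n b : Fin n) : ℕ) = 19) ∨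
    ((b : ℕ) = 15 ∧ ((σA n b : Fin n) : ℕ) = 5) ∨
    ((b : ℕ) = 17 ∧ ((σA n b : Fin n) : ℕ) = 11) ∨
    ((b : ℕ) = 19 ∧ ((σA n b : Fin n) : ℕ) = 13) ∨
    ((b : ℕ) = 20 ∧ ((σA n b : Fin n) : ℕ) = 4) ∨
    ((b : ℕ) = 21 ∧ ((σA n b : Fin n) : ℕ) = 23) ∨
    ((b : ℕ) = 22 ∧ ((σA n b : Fin n) : ℕ) = 8) ∨
    ((b : ℕ) = 23 ∧ ((σA n b : Fin n) : ℕ) = 21) ∨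
    (24 ≤ (b : ℕ) ∧ ((b : ℕ) - 24) % 4 < 2 ∧ ((σA n b : Fin n) : ℕ) = (b : ℕ) + 2) ∨
    (24 ≤ (b : ℕ) ∧ 2 ≤ ((b : ℕ) - 24) % 4 ∧ ((σA n b : Fin n) : ℕ) = (b : ℕ) - 2) := by
  have hlt := b.isLt
  simp only [vA, decide_eq_true_eq] at hb
  simp only [σA, Fin.val_mk]
  generalize hbt : (b : ℕ) = t at *
  by_cases hT : 24 ≤ t
  · have e : σAval t = if (t - 24) % 4 < 2 then t + 2 else t - 2 := by unfold σAval; rw [if_pos hT]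
    rw [e]
    split_ifs with hc
    · iterate 18 right
      left; exact ⟨hT, hc, by omega⟩
    · iterate 19 right
      exact ⟨hT, by omega, by omega⟩
  · interval_cases t <;> first | (exfalso; omega) | (simp [σAval] <;> omega)

/-- ParityDial helper `vA_σA`: the pairing preserves the support. -/
theorem vA_σA (hn : 24 ≤ n) (h4 : n % 4 = 0) (b : Fin n) (hb : vA n b = true) : vA n (σA n b) = true := by
  have h := σA_val hn h4 b hb
  have hb' : VA b := by simpa only [vA, decide_eq_true_eq] using hb
  simp only [vA, decide_eq_true_eq]
  rcases h with h | h | h | h | h | h | h | h | h | h | h | h | h | h | h | h | h | h | h | h <;> omega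

/-- ParityDial helper `par_σA`: the pairing preserves the position parity. -/
theorem par_σA (hn : 24 ≤ n) (h4 : n % 4 = 0) (b : Fin n) (hb : vA n b = true) : par (σA n b) = par b := by
  have h := σA_val hn h4 b hb
  simp only [par, decide_eq_decide]
  rcases h with h | h | h | h | h | h | h | h | h | h | h | h | h | h | h | h | h | h | h | h <;> omega

/-- ParityDial helper `σA_ne`: the pairing is fixed-point free on the support. -/
theorem σA_ne (hn : 24 ≤ n) (h4 : n % 4 = 0) (b : Fin n) (hb : vA n b = true) : σA n b ≠ b := by
  have h := σA_val hn h4 b hb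
  intro he
  have h' := congrArg Fin.val he
  rcases h with h | h | h | h | h | h | h | h | h | h | h | h | h | h | h | h | h | h | h | h <;> omega

/-- ParityDial helper `σA_σA`: the pairing is an involution on the support. -/
theorem σA_σA (hn : 24 ≤ n) (h4 : n % 4 = 0) (b : Fin n) (hb : vA n b = true) : σA n (σA n b) = b := by
  have h1 := σA_val hn h4 b hb
  have h2 := σA_val hn h4 (σA n b) (vA_σA hn h4 b hb)
  apply Fin.ext
  rcases h1 with h | h | h | h | h | h | h | h | h | h | h | h | h | h | h | h | h | h | h | h <;> omega

set_option maxHeartbeats 4000000 in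
/-- ParityDial helper `window_σA`: the pairing preserves the radius-1 window of `xA`. -/
theorem window_σA (hn : 24 ≤ n) (h4 : n % 4 = 0) (b : Fin n) (hb : vA n b = true) :
    window 1 (xA n) (σA n b) = window 1 (xA n) b := by
  have h := σA_val hn h4 b hb
  have hlt := b.isLt
  funext d
  have hd := d.isLt
  rw [window_apply 1 (by omega), window_apply 1 (by omega)]
  simp only [xA, decide_eq_decide]
  generalize hs : ((σA n b : Fin n) : ℕ) = s at *
  generalize hdd : (d : ℕ) = dd at *
  generalize ht : (b : ℕ) = t at *
  interval_cases dd <;>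
  · rcases h with ⟨rfl, rfl⟩ | ⟨rfl, rfl⟩ | ⟨rfl, rfl⟩ | ⟨rfl, rfl⟩ | ⟨rfl, rfl⟩ | ⟨rfl, rfl⟩ | ⟨rfl, rfl⟩ | ⟨rfl, rfl⟩ | ⟨rfl, rfl⟩ | ⟨rfl, rfl⟩ | ⟨rfl, rfl⟩ | ⟨rfl, rfl⟩ | ⟨rfl, rfl⟩ | ⟨rfl, rfl⟩ | ⟨rfl, rfl⟩ | ⟨rfl, rfl⟩ | ⟨rfl, rfl⟩ | ⟨rfl, rfl⟩ | ⟨hT, hm, rfl⟩ | ⟨hT, hm, rfl⟩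
    all_goals (split_ifs <;> ((try simp) <;> omega))

/-- ParityDial helper `inKernel_vA`: `vA` is a kernel vector of `xA` (`n ≥ 24`). -/
theorem inKernel_vA (hn : 24 ≤ n) : InKernel (xA n) (vA n) := by
  intro b
  rw [xor3_eq_false_iff]
  have hb := b.isLt
  simp only [vA, xA, Bool.and_eq_true, decide_eq_true_eq, ne_eq, decide_eq_decide, prv_val, nxt_val]
  split_ifs <;> omega

/-- ParityDial helper `edgesIn_vA`: the support has `n − 12` inner edges. -/
theorem edgesIn_vA (hn : 24 ≤ n) : edgesIn (vA n) = n - 12 := by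
  unfold edgesIn
  have h : (univ.filter fun b : Fin n => vA n b = true ∧ vA n (nxt b) = true)
      = univ \ ({1, 2, 6, 7, 8, 9, 13, 14, 15, 16, 17, 18} : Finset ℕ).attachFin (by
          intro t ht; simp only [mem_insert, mem_singleton] at ht; omega) := by
    ext b
    have hb := b.isLt
    simp only [mem_filter, mem_univ, true_and, mem_sdiff, mem_attachFin, vA, decide_eq_true_eq, nxt_val, mem_insert,
      mem_singleton]
    split_ifs <;> omega
  have hc : ({1, 2, 6, 7, 8, 9, 13, 14, 15, 16, 17, 18} : Finset ℕ).card = 12 := by rfl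
  rw [h, card_sdiff_of_subset (subset_univ _), card_attachFin, card_univ, Fintype.card_fin, hc]

/-- ParityDial helper `wtAnd_xA`: `6` ones of `xA` lie in the support. -/
theorem wtAnd_xA (hn : 24 ≤ n) : wtAnd (xA n) (vA n) = 6 := by
  unfold wtAnd
  have h : (univ.filter fun b : Fin n => xA n b = true ∧ vA n b = true)
      = ({1, 3, 6, 10, 13, 19} : Finset ℕ).attachFin (by intro t ht; simp only [mem_insert, mem_singleton] at ht; omega) := by
    ext b
    have hb := b.isLt
    simp only [mem_filter, mem_univ, true_and, mem_attachFin, vA, xA, decide_eq_true_eq, mem_insert, mem_singleton]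
    omega
  have hc : ({1, 3, 6, 10, 13, 19} : Finset ℕ).card = 6 := by rfl
  rw [h, card_attachFin, hc]

/-- ParityDial helper `signBit_xA`: the sign bit of the certificate is `1` (`n` even, `n ≥ 24`). -/
theorem signBit_xA (hn : 24 ≤ n) (h4 : n % 4 = 0) : signBit (xA n) (vA n) = 1 := by
  unfold signBit; rw [edgesIn_vA hn, wtAnd_xA hn]; omega

/-- ParityDial helper `card_zeros_xA`: `xA` has `n − 7` zeros. -/
theorem card_zeros_xA (hn : 24 ≤ n) : (univ.filter fun b : Fin n => xA n b = false).card = n - 7 := by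
  have h : (univ.filter fun b : Fin n => xA n b = false)
      = univ \ ({1, 3, 6, 10, 13, 16, 19} : Finset ℕ).attachFin (by
          intro t ht; simp only [mem_insert, mem_singleton] at ht; omega) := by
    ext b
    simp only [mem_filter, mem_univ, true_and, mem_sdiff, mem_attachFin, xA, decide_eq_false_iff_not, mem_insert,
      mem_singleton]
  have hc : ({1, 3, 6, 10, 13, 16, 19} : Finset ℕ).card = 7 := by rfl
  rw [h, card_sdiff_of_subset (subset_univ _), card_attachFin, card_univ, Fintype.card_fin, hc]

/-- ParityDial helper `oddZeros_xA`: `xA` lies in the odd class when `n` is even (`n ≥ 24`). -/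
theorem oddZeros_xA (hn : 24 ≤ n) (h4 : n % 4 = 0) : OddZeros (xA n) := by
  unfold OddZeros; rw [card_zeros_xA hn]; omega

/-- ParityDial helper `wt_xA`: `xA` is LIGHT — weight `≤ 7` (exactly 7 once `n ≥ 20`). -/
theorem wt_xA (n : ℕ) : wt (xA n) ≤ 7 :=
  wt_le_of_val_mem [1, 3, 6, 10, 13, 16, 19] fun j hj => by
    simp only [xA, decide_eq_true_eq] at hj
    simp only [List.mem_cons, List.not_mem_nil, or_false]
    omega

/-- ★ FAMILY A IS PARITY-UNIVERSAL-HARD: for every `n ≡ 0 (mod 4)`, `n ≥ 24`, the weight-7 input `xA n` defeats EVERY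
parity-aware radius-1 rule (hence every such rule with any input-global advice, `parityUniversalHard_any_advice`). -/
theorem xA_parityUniversalHard (hn : 24 ≤ n) (h4 : n % 4 = 0) : ParityUniversalHard 1 (xA n) :=
  parityUniversalHard_of_pairing 1 (xA n) (vA n) (σA n) (oddZeros_xA hn h4) (inKernel_vA hn)
    (signBit_xA hn h4) (vA_σA hn h4) (window_σA hn h4) (par_σA hn h4) (σA_ne hn h4) (σA_σA hn h4)

end Summit.QuantumAdvantage.QuantumAdvantage.Theorems.ParityDial
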